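import Literature.MathematicalPhysics.QuantumLattice.DWaveNodalShellVolume
import Mathlib.MeasureTheory.Integral.Layercake
import Mathlib.Analysis.SpecialFunctions.Integrals.Basic
import HarnessLib

/-!
# The `T²`-law of the nodal `d`-wave band: `∫ e^{-βE} ≤ C/(Δβ²)`

Topic `Literature/MathematicalPhysics/QuantumLattice`; the thermodynamic (layer-cake) consequence of
`DWaveNodalShellVolume.exists_planarNodalShellVolume_le_twoPi` (area of `{E < t}` on the period square
`[0, 2π)²` is `≤ C t²/Δ`, `E = √((ε-μ)² + Δ²d²)` the `d`-wave Bogoliubov–de Gennes band,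
`ε = -2(cos k₁ + cos k₂)`, `d = cos k₁ - cos k₂`).

* `exists_lintegral_exp_neg_mul_bdgEnergy_le` — **Boltzmann weight of the nodal band**: for a compact
  sub-band `[μ₁, μ₂] ⊂ (-4, 0)` and `Δ₀ > 0` there is `C ≥ 0` with
  `∫_{[0,2π)²} e^{-β E(k)} dk ≤ C/(Δ β²)` for all `μ ∈ [μ₁, μ₂]`, `0 < Δ ≤ Δ₀`, `β > 0`.
  Proof: layer cake `∫ e^{-βE} = ∫₀¹ vol{e^{-βE} > s} ds = ∫₀¹ vol{E < log(1/s)/β} ds`, the nodal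
  shell-volume estimate, and `log(1/s)² ≤ 16 s^{-1/2}` (`Real.log_le_rpow_div`), `∫₀¹ s^{-1/2} ds = 2`.

Since `log(1 + e^{-βE}) ≤ e^{-βE}`, the thermal part of the free `d`-wave BdG pressure,
`(2/β)(4π²)⁻¹ ∫ log(1 + e^{-βE})`, is `O(T³/Δ)`, and the nodal quasi-particles carry the `T²` entropy /
`T`-linear-in-`T` specific heat coefficient of a clean `d`-wave superconductor — here as inequalities with
constants uniform in the level window and in the gap `Δ ≤ Δ₀` (the form needed for estimates that are
uniform in the temperature and in a regulated pair source). Everything is proved; no definitions. [folklore]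

## Sources

Folklore (nodal thermodynamics of `d`-wave superconductors: N. E. Hussey, Adv. Phys. 51 (2002) 1685, §2;
A. C. Durst, P. A. Lee, Phys. Rev. B 62 (2000) 1270, §II); layer-cake formula: E. H. Lieb, M. Loss,
*Analysis* (2001), Thm 1.13 (Mathlib `MeasureTheory.lintegral_eq_lintegral_meas_lt`).
-/

noncomputable section

open Real Set Filter MeasureTheory MeasureTheory.Measure
open scoped Topology ENNReal

namespace Literature.MathematicalPhysics.QuantumLattice

/-- `∫₀¹ s^{-1/2} ds = 2` as a Lebesgue integral over `(0, 1)`. [folklore] -/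
theorem lintegral_rpow_neg_half_Ioo :
    ∫⁻ s in Ioo (0 : ℝ) 1, ENNReal.ofReal (s ^ (-(1 / 2 : ℝ))) = ENNReal.ofReal 2 := by
  have hr : (-1 : ℝ) < -(1 / 2) := by norm_num
  have hint : IntegrableOn (fun s : ℝ => s ^ (-(1 / 2 : ℝ))) (Ioo 0 1) volume := by
    have h := (intervalIntegral.intervalIntegrable_rpow' hr (a := 0) (b := 1)).1
    exact h.mono_set Ioo_subset_Ioc_self
  have hnn : 0 ≤ᵐ[volume.restrict (Ioo (0 : ℝ) 1)] fun s : ℝ => s ^ (-(1 / 2 : ℝ)) := by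
    filter_upwards [ae_restrict_mem measurableSet_Ioo] with s hs
    exact Real.rpow_nonneg hs.1.le _
  rw [← ofReal_integral_eq_lintegral_ofReal hint hnn]
  congr 1
  rw [← integral_Ioc_eq_integral_Ioo, ← intervalIntegral.integral_of_le zero_le_one, integral_rpow (Or.inl hr)]
  rw [Real.one_rpow, Real.zero_rpow (by norm_num)]
  norm_num

/-- `log(1/s)² ≤ 16 s^{-1/2}` for `0 < s` (from `log x ≤ 4 x^{1/4}`). [folklore] -/
theorem log_sq_le_rpow_neg_half {s : ℝ} (hs : 0 < s) (hs1 : s < 1) :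
    Real.log s ^ 2 ≤ 16 * s ^ (-(1 / 2 : ℝ)) := by
  have h1 : Real.log s⁻¹ ≤ (s⁻¹) ^ (1 / 4 : ℝ) / (1 / 4) :=
    Real.log_le_rpow_div (inv_pos.2 hs).le (by norm_num)
  have h0 : 0 ≤ Real.log s⁻¹ := Real.log_nonneg (one_le_inv_iff₀.2 ⟨hs, hs1.le⟩)
  rw [Real.log_inv] at h1 h0
  have h2 : (-Real.log s) ^ 2 ≤ ((s⁻¹) ^ (1 / 4 : ℝ) / (1 / 4)) ^ 2 := pow_le_pow_left₀ h0 h1 2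
  have h3 : ((s⁻¹) ^ (1 / 4 : ℝ) / (1 / 4)) ^ 2 = 16 * s ^ (-(1 / 2 : ℝ)) := by
    rw [div_pow, ← Real.rpow_natCast, ← Real.rpow_mul (inv_pos.2 hs).le, Real.inv_rpow hs.le,
      ← Real.rpow_neg hs.le]
    norm_num
    ring
  calc Real.log s ^ 2 = (-Real.log s) ^ 2 := by ring
    _ ≤ _ := h2
    _ = _ := h3

/-- **The `T²`-law of the nodal `d`-wave band (Boltzmann weight).** For `[μ₁, μ₂] ⊂ (-4, 0)` and
`Δ₀ > 0` there is `C ≥ 0` such that for all `μ ∈ [μ₁, μ₂]`, `0 < Δ ≤ Δ₀` and `β > 0`,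
`∫_{[0,2π)²} exp(-β √((ε-μ)² + Δ²d²)) ≤ C / (Δ β²)`. [folklore] -/
theorem exists_lintegral_exp_neg_mul_bdgEnergy_le {μ₁ μ₂ Δ₀ : ℝ} (hμ₁ : -4 < μ₁) (hμ₂ : μ₂ < 0)
    (hΔ₀ : 0 < Δ₀) :
    ∃ C : ℝ, 0 ≤ C ∧ ∀ μ ∈ Icc μ₁ μ₂, ∀ Δ ∈ Ioc (0 : ℝ) Δ₀, ∀ β : ℝ, 0 < β →
      ∫⁻ x in {x : ℝ × ℝ | x.1 ∈ Ico 0 (2 * π) ∧ x.2 ∈ Ico 0 (2 * π)},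
        ENNReal.ofReal (Real.exp (-(β * Real.sqrt ((-2 * (Real.cos x.1 + Real.cos x.2) - μ) ^ 2 +
          (Δ * (Real.cos x.1 - Real.cos x.2)) ^ 2)))) ≤ ENNReal.ofReal (C / (Δ * β ^ 2)) := by
  obtain ⟨C₀, hC₀, hvol⟩ := exists_planarNodalShellVolume_le_twoPi hμ₁ hμ₂ hΔ₀
  refine ⟨32 * C₀, by positivity, fun μ hμ Δ hΔ β hβ => ?_⟩
  have hΔ0 : 0 < Δ := hΔ.1
  set Q₀ : Set (ℝ × ℝ) := {x : ℝ × ℝ | x.1 ∈ Ico 0 (2 * π) ∧ x.2 ∈ Ico 0 (2 * π)} with hQ₀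
  set F : ℝ × ℝ → ℝ := fun x =>
    (-2 * (Real.cos x.1 + Real.cos x.2) - μ) ^ 2 + (Δ * (Real.cos x.1 - Real.cos x.2)) ^ 2 with hF
  set f : ℝ × ℝ → ℝ := fun x => Real.exp (-(β * Real.sqrt (F x))) with hf
  have hFc : Continuous F := by rw [hF]; fun_prop
  have hfc : Continuous f := by rw [hf]; fun_prop
  have hf_nn : 0 ≤ᵐ[volume.restrict Q₀] f := Eventually.of_forall fun x => (Real.exp_pos _).le
  have hf_le : ∀ x, f x ≤ 1 := fun x => by
    rw [hf]
    simp only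
    rw [Real.exp_le_one_iff, neg_nonpos]
    exact mul_nonneg hβ.le (Real.sqrt_nonneg _)
  have hQ₀m : MeasurableSet Q₀ := by
    have : Q₀ = Ico (0 : ℝ) (2 * π) ×ˢ Ico (0 : ℝ) (2 * π) := by ext x; simp [hQ₀, mem_prod]
    rw [this]; exact measurableSet_Ico.prod measurableSet_Ico
  -- layer cake
  have hlc := lintegral_eq_lintegral_meas_lt (volume.restrict Q₀) hf_nn hfc.measurable.aemeasurable
  show ∫⁻ x in Q₀, ENNReal.ofReal (f x) ≤ ENNReal.ofReal (32 * C₀ / (Δ * β ^ 2))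
  rw [hlc]
  -- the level sets of the Boltzmann weight
  set K : ℝ := 16 * C₀ / (β ^ 2 * Δ) with hK
  have hK0 : 0 ≤ K := by positivity
  have hbound : ∀ t ∈ Ioi (0 : ℝ), (volume.restrict Q₀) {x : ℝ × ℝ | t < f x} ≤
      (Ioo (0 : ℝ) 1).indicator (fun t => ENNReal.ofReal (K * t ^ (-(1 / 2 : ℝ)))) t := by
    intro t ht
    have ht0 : 0 < t := ht
    have hmeas : MeasurableSet {x : ℝ × ℝ | t < f x} := measurableSet_lt measurable_const hfc.measurable
    rw [Measure.restrict_apply hmeas]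
    rcases lt_or_ge t 1 with ht1 | ht1
    · rw [indicator_of_mem (show t ∈ Ioo (0 : ℝ) 1 from ⟨ht0, ht1⟩)]
      -- `{t < e^{-βE}} ∩ Q₀ ⊆ {x ∈ Q₀ | F x < (log(1/t)/β)²}`
      set s : ℝ := -Real.log t / β with hs
      have hlog : 0 < -Real.log t := by
        have := Real.log_neg ht0 ht1
        linarith
      have hs0 : 0 < s := div_pos hlog hβ
      have hsub : {x : ℝ × ℝ | t < f x} ∩ Q₀ ⊆
          {x : ℝ × ℝ | (x.1 ∈ Ico 0 (2 * π) ∧ x.2 ∈ Ico 0 (2 * π)) ∧ F x < s ^ 2} := by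
        rintro x ⟨hx, hxQ⟩
        refine ⟨hxQ, ?_⟩
        have hx' : t < Real.exp (-(β * Real.sqrt (F x))) := hx
        rw [← Real.log_lt_iff_lt_exp ht0] at hx'
        have hE : Real.sqrt (F x) < s := by
          rw [hs, lt_div_iff₀ hβ]; linarith
        rwa [Real.sqrt_lt' hs0] at hE
      calc volume ({x : ℝ × ℝ | t < f x} ∩ Q₀)
          ≤ volume {x : ℝ × ℝ | (x.1 ∈ Ico 0 (2 * π) ∧ x.2 ∈ Ico 0 (2 * π)) ∧ F x < s ^ 2} :=
            measure_mono hsub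
        _ ≤ ENNReal.ofReal (C₀ * s ^ 2 / Δ) := hvol μ hμ Δ hΔ s hs0
        _ ≤ ENNReal.ofReal (K * t ^ (-(1 / 2 : ℝ))) := by
            refine ENNReal.ofReal_le_ofReal ?_
            have hl := log_sq_le_rpow_neg_half ht0 ht1
            have e : s ^ 2 = Real.log t ^ 2 / β ^ 2 := by rw [hs]; ring
            rw [e, hK]
            have hβ2 : 0 < β ^ 2 := by positivity
            calc C₀ * (Real.log t ^ 2 / β ^ 2) / Δ = C₀ / (β ^ 2 * Δ) * Real.log t ^ 2 := by
                  field_simp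
              _ ≤ C₀ / (β ^ 2 * Δ) * (16 * t ^ (-(1 / 2 : ℝ))) :=
                  mul_le_mul_of_nonneg_left hl (by positivity)
              _ = 16 * C₀ / (β ^ 2 * Δ) * t ^ (-(1 / 2 : ℝ)) := by ring
    · rw [indicator_of_notMem (fun h : t ∈ Ioo (0 : ℝ) 1 => not_lt.2 ht1 h.2)]
      have hempty : {x : ℝ × ℝ | t < f x} = ∅ := by
        ext x
        simp only [mem_setOf_eq, mem_empty_iff_false, iff_false, not_lt]
        exact (hf_le x).trans ht1
      rw [hempty, empty_inter, measure_empty]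
  calc ∫⁻ t in Ioi (0 : ℝ), (volume.restrict Q₀) {x : ℝ × ℝ | t < f x}
      ≤ ∫⁻ t in Ioi (0 : ℝ), (Ioo (0 : ℝ) 1).indicator (fun t => ENNReal.ofReal (K * t ^ (-(1 / 2 : ℝ)))) t :=
        setLIntegral_mono' measurableSet_Ioi hbound
    _ = ∫⁻ t in Ioo (0 : ℝ) 1, ENNReal.ofReal (K * t ^ (-(1 / 2 : ℝ))) := by
        rw [lintegral_indicator measurableSet_Ioo, Measure.restrict_restrict measurableSet_Ioo,
          show Ioo (0 : ℝ) 1 ∩ Ioi 0 = Ioo 0 1 from inter_eq_left.2 Ioo_subset_Ioi_self]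
    _ = ENNReal.ofReal K * ∫⁻ t in Ioo (0 : ℝ) 1, ENNReal.ofReal (t ^ (-(1 / 2 : ℝ))) := by
        rw [← lintegral_const_mul' _ _ ENNReal.ofReal_ne_top]
        refine setLIntegral_congr_fun measurableSet_Ioo (fun t ht => ?_)
        rw [ENNReal.ofReal_mul hK0]
    _ = ENNReal.ofReal K * ENNReal.ofReal 2 := by rw [lintegral_rpow_neg_half_Ioo]
    _ = ENNReal.ofReal (32 * C₀ / (Δ * β ^ 2)) := by
        rw [← ENNReal.ofReal_mul hK0]
        congr 1
        rw [hK]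
        field_simp
        ring

end Literature.MathematicalPhysics.QuantumLattice

end
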